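import Literature.MathematicalPhysics.StatisticalMechanics.DiluteHardSphereGasProofs
import HarnessLib

/-!
# Uniqueness and translation invariance of the low-activity hard-sphere Gibbs state (`ℝ³`, DLR class `IsHardSphereGibbs`)

Topic `Literature/MathematicalPhysics/StatisticalMechanics`; PROOFS ONLY (no definitions, no named facts).

The tree carries two formalisations of the DLR equations of the hard-sphere gas with Maxwellian velocity marks on
`ℝ³ × ℝ³`: the series form `Literature.Analysis.FluidPDE.IsHardSphereGibbs σ z β u μ` (`InfiniteHardSphereFlow.lean`) and
the Poisson form `Literature.MathematicalPhysics.KineticTheory.IsHsLocalGibbs σ ν μ` (`RiemannLocalGibbsLaw.lean`), for which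
uniqueness at small activity is PROVED (`IsHsLocalGibbs.unique_of_small_activity`, Michelen–Perkins 2021 Thm 3/25 route).
`DiluteHardSphereGasProofs.lean` identified the two finite-volume specifications on hard-core boundary conditions
(`hsLocalSpec_eq_gibbsSpec`) and derived `IsHsLocalGibbs ⇒ IsHardSphereGibbs`.  This file supplies the converse and
transfers uniqueness and translation invariance to the `FluidPDE` class:

* `IsHardSphereGibbs.ae_isHardCore` — a DLR state in the series sense is carried by hard-core configurations (the
  specification of the window `B(0,n)` gives no mass to configurations whose restriction to `B(0,n) × ℝ³` violates the
  hard core; all `n`);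
* `isHsLocalGibbs_of_isHardSphereGibbs`, `isHardSphereGibbs_iff_isHsLocalGibbs` — the two DLR classes COINCIDE for
  the intensity `ν = z · Leb ⊗ M_β(v-u) dv` (`0 ≤ z`, `0 < β`);
* `IsHardSphereGibbs.unique_of_small_activity` — for `0 < σ`, `0 ≤ z`, `16 z σ³ < 1`, `0 < β`, two hard-sphere Gibbs
  states `IsHardSphereGibbs σ z β u` coincide (Ruelle 1969 Thm 4.2.3 is the correlation-function version at
  `|z| < e^{-1} C(β)^{-1}`; the DLR-level statement for repulsive pair potentials with an activity function is
  Michelen–Perkins 2021 Thm 3, here with the crude threshold `2 · 8 z σ³ < 1` of the tree's proof);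
* `IsHardSphereGibbs.isTranslationInvariant_of_small_activity` — in that regime every such state is translation
  invariant (`Literature.Analysis.FluidPDE.IsTranslationInvariant`), by uniqueness and translation covariance of the
  DLR equations (`IsHsLocalGibbs.map_shift`).

This is ingredient (A), in dimension `3`, of the named fact
`Literature.MathematicalPhysics.KineticTheory.HardSphereGibbsLowDensityUniqueness` (`Georgii1995HardSphereCanonicalLocalLimit.lean`).

## References

* D. Ruelle, *Statistical Mechanics: Rigorous Results* (1969), §4.2 Thm 4.2.3 (held: PDF p. 69). [Ruelle1969]
* M. Michelen, W. Perkins, *Potential-weighted connective constants and uniqueness of Gibbs measures*,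
  arXiv:2109.01094, Thm 3, Thm 25. [MichelenPerkins2021]
* H.-O. Georgii, *Gibbs Measures and Phase Transitions* (2011), Def. 1.23 (DLR equations). [Georgii2011]
-/

noncomputable section

open MeasureTheory ProbabilityTheory Set Filter Function
open scoped ENNReal NNReal Topology

namespace Literature.MathematicalPhysics.StatisticalMechanics

open Literature.Analysis.FunctionSpaces Literature.Analysis.FluidPDE
open Literature.MathematicalPhysics.KineticTheory
open HardSphere (Pos Phase window hardCoreSet glue poissonLaw)

/-! ### A `FluidPDE` hard-sphere Gibbs state is carried by hard-core configurations -/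

section HardCore

variable {σ z β : ℝ} {u : Pos} {μ : Measure (PointConfig Phase)}

/-- If a configuration satisfies the hard core IN the window `Λ`, its restriction to `Λ × ℝ³` is a hard-core
configuration. [folklore] -/
theorem isHardCore_restrict_window_of_hardCoreIn {σ : ℝ} {Λ : Set Pos} {X : PointConfig Phase}
    (hX : HardCoreIn σ Λ X) : HardSphere.IsHardCore σ (X.restrict (window Λ)) := by
  intro p hp q hq hpq
  have hp' : p ∈ X.carrier ∩ window Λ := hp
  have hq' : q ∈ X.carrier ∩ window Λ := hq
  rw [dist_eq_norm]
  exact hX p hp'.1 q hq'.1 hpq (Or.inl (HardSphere.mem_window.1 hp'.2))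

/-- The event "the restriction to `Λ × ℝ³` violates the hard core" is measurable. [folklore] -/
theorem measurableSet_restrict_window_not_mem_hardCoreSet (σ : ℝ) {Λ : Set Pos} (hΛ : MeasurableSet Λ) :
    MeasurableSet {c : PointConfig Phase | c.restrict (window Λ) ∉ hardCoreSet σ} :=
  (HardSphere.measurableSet_hardCoreSet σ).compl.preimage
    (PointConfig.measurable_restrict (HardSphere.measurableSet_window hΛ))

/-- The series specification of the window `Λ` gives no weight to configurations whose restriction to `Λ × ℝ³`
violates the hard core. [folklore] -/
theorem gibbsWeight_restrict_window_not_mem_hardCoreSet (σ z β : ℝ) (u : Pos) (Λ : Set Pos) (Y : PointConfig Phase) :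
    gibbsWeight σ z β u Λ Y {c : PointConfig Phase | c.restrict (window Λ) ∉ hardCoreSet σ} = 0 := by
  unfold gibbsWeight
  refine ENNReal.tsum_eq_zero.2 fun k => ?_
  have hzero : ∀ x : Fin k → Phase,
      ({c : PointConfig Phase | c.restrict (window Λ) ∉ hardCoreSet σ} ∩ {X | HardCoreIn σ Λ X}).indicator
        (1 : PointConfig Phase → ℝ≥0∞) (superposeIn Λ x Y) = 0 := fun x => by
    refine indicator_of_notMem (fun h => h.1 ?_) _
    exact isHardCore_restrict_window_of_hardCoreIn h.2
  simp_rw [hzero]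
  rw [lintegral_zero, mul_zero]

/-- Under a hard-sphere Gibbs state, almost surely the restriction to every bounded measurable window is a hard-core
configuration. [folklore] -/
theorem _root_.Literature.Analysis.FluidPDE.IsHardSphereGibbs.measure_restrict_window_not_mem_hardCoreSet
    (h : IsHardSphereGibbs σ z β u μ)
    {Λ : Set Pos} (hΛ : MeasurableSet Λ) (hb : Bornology.IsBounded Λ) :
    μ {c : PointConfig Phase | c.restrict (window Λ) ∉ hardCoreSet σ} = 0 := by
  rw [h.2 Λ hΛ hb _ (measurableSet_restrict_window_not_mem_hardCoreSet σ hΛ)]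
  have hspec : ∀ Y : PointConfig Phase,
      gibbsSpec σ z β u Λ Y {c : PointConfig Phase | c.restrict (window Λ) ∉ hardCoreSet σ} = 0 := fun Y => by
    rw [gibbsSpec, gibbsWeight_restrict_window_not_mem_hardCoreSet, ENNReal.zero_div]
  simp_rw [hspec]
  rw [lintegral_zero]

/-- **A hard-sphere Gibbs state (series DLR class) is carried by hard-core configurations.** [folklore] -/
theorem _root_.Literature.Analysis.FluidPDE.IsHardSphereGibbs.ae_isHardCore (h : IsHardSphereGibbs σ z β u μ) : ∀ᵐ c ∂μ, HardSphere.IsHardCore σ c := by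
  have hall : ∀ᵐ c ∂μ, ∀ n : ℕ, c.restrict (window (Metric.ball (0 : Pos) n)) ∈ hardCoreSet σ := by
    refine ae_all_iff.2 fun n => ?_
    rw [ae_iff]
    simpa only [not_not] using
      h.measure_restrict_window_not_mem_hardCoreSet Metric.isOpen_ball.measurableSet Metric.isBounded_ball
  filter_upwards [hall] with c hc
  intro p hp q hq hpq
  obtain ⟨n, hn⟩ := exists_nat_gt (max ‖p.1‖ ‖q.1‖)
  have hpn : p ∈ c.restrict (window (Metric.ball (0 : Pos) n)) :=
    ⟨hp, HardSphere.mem_window.2 (mem_ball_zero_iff.2 ((le_max_left _ _).trans_lt hn))⟩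
  have hqn : q ∈ c.restrict (window (Metric.ball (0 : Pos) n)) :=
    ⟨hq, HardSphere.mem_window.2 (mem_ball_zero_iff.2 ((le_max_right _ _).trans_lt hn))⟩
  exact hc n p hpn q hqn hpq

end HardCore

/-! ### The two DLR classes coincide -/

section Bridge

variable {z β : ℝ} (u : Pos)

/-- **DLR states for `FluidPDE.gibbsSpec` are DLR states for `hsLocalSpec`** (converse of
`isHardSphereGibbs_of_isHsLocalGibbs`): a hard-sphere Gibbs state `IsHardSphereGibbs σ z β u μ` solves the DLR equations
`IsHsLocalGibbs σ (z · Leb ⊗ M_β(v-u)dv)` — it is carried by hard-core configurations, on which the two specifications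
agree. [cite: Georgii2011, Def. 1.23] -/
theorem isHsLocalGibbs_of_isHardSphereGibbs (hz : 0 ≤ z) (hβ : 0 < β) {σ : ℝ} {μ : Measure (PointConfig Phase)}
    (hμ : IsHardSphereGibbs σ z β u μ) :
    IsHsLocalGibbs σ ((Real.toNNReal z) • ((volume : Measure Pos).prod
      ((volume : Measure Pos).withDensity fun v => ENNReal.ofReal (maxwellianBeta β (v - u))))) μ := by
  refine ⟨hμ.1, fun Λ hΛ hb A hA => ?_⟩
  rw [hμ.2 Λ hΛ hb A hA]
  refine lintegral_congr_ae (hμ.ae_isHardCore.mono fun η hη => ?_)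
  exact hsLocalSpec_eq_gibbsSpec u hz hβ hΛ hb hη hA

/-- **The two DLR formalisations of the hard-sphere gas define the same class of states** (`0 ≤ z`, `0 < β`).
[cite: Georgii2011, Def. 1.23] -/
theorem isHardSphereGibbs_iff_isHsLocalGibbs (hz : 0 ≤ z) (hβ : 0 < β) {σ : ℝ} {μ : Measure (PointConfig Phase)} :
    IsHardSphereGibbs σ z β u μ ↔ IsHsLocalGibbs σ ((Real.toNNReal z) • ((volume : Measure Pos).prod
      ((volume : Measure Pos).withDensity fun v => ENNReal.ofReal (maxwellianBeta β (v - u))))) μ :=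
  ⟨isHsLocalGibbs_of_isHardSphereGibbs u hz hβ, isHardSphereGibbs_of_isHsLocalGibbs u hz hβ⟩

end Bridge

/-! ### Uniqueness and translation invariance at small activity -/

section Unique

variable {σ z β : ℝ} {u : Pos}

/-- The hypotheses of the tree's uniqueness theorem for the intensity `ν = z · Leb ⊗ M_β(v-u)dv` at `16 z σ³ < 1`:
`ν` is atomless, charges no hyperplane `{q₁ = t}`, gives mass `≤ 8 z σ³` to every ball window `B°_σ(a) × ℝ³`
(`vol B_σ ≤ (2σ)³`) with `2 · 8 z σ³ < 1`, and finite mass to the windows of balls. [folklore] -/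
theorem smul_prod_uniqueness_hypotheses (hσ : 0 < σ) (hz : 0 ≤ z) (hzσ : 16 * (z * σ ^ 3) < 1) (hβ : 0 < β)
    (u : Pos) :
    let ν : Measure Phase := (Real.toNNReal z) • ((volume : Measure Pos).prod
      ((volume : Measure Pos).withDensity fun v => ENNReal.ofReal (maxwellianBeta β (v - u))))
    (∀ x, ν {x} = 0) ∧ (∀ t : ℝ, ν {y : Phase | y.1 0 = t} = 0) ∧ 0 ≤ 8 * (z * σ ^ 3) ∧
      (∀ a : Pos, ν (window (Metric.ball a σ)) ≤ ENNReal.ofReal (8 * (z * σ ^ 3))) ∧ 2 * (8 * (z * σ ^ 3)) < 1 ∧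
      (∀ R : ℝ, ν (window (Metric.ball (0 : Pos) R)) ≠ ∞) := by
  haveI := isProbabilityMeasure_withDensity_maxwellianBeta hβ u
  set M : Measure Pos := (volume : Measure Pos).withDensity fun v => ENNReal.ofReal (maxwellianBeta β (v - u)) with hM
  have hσ3 : 0 ≤ z * σ ^ 3 := mul_nonneg hz (pow_nonneg hσ.le 3)
  refine ⟨smul_prod_singleton z M, smul_prod_setOf_fst_apply_zero z M, by positivity, fun a => ?_, by linarith,
    fun R => ?_⟩
  · rw [smul_prod_window, measure_univ, mul_one, show 8 * (z * σ ^ 3) = z * (8 * σ ^ 3) by ring,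
      ENNReal.ofReal_mul hz]
    gcongr
    calc volume (Metric.ball a σ) ≤ ENNReal.ofReal (2 * σ) ^ 3 := volume_ball_le a σ
      _ = ENNReal.ofReal (8 * σ ^ 3) := by
          rw [← ENNReal.ofReal_pow (by linarith)]
          congr 1
          ring
  · rw [smul_prod_window, measure_univ, mul_one]
    exact ENNReal.mul_ne_top ENNReal.ofReal_ne_top Metric.isBounded_ball.measure_lt_top.ne

/-- **Uniqueness of the hard-sphere Gibbs state at small activity** (`ℝ³`, DLR class `IsHardSphereGibbs`): for
`0 < σ`, `0 ≤ z` with `16 z σ³ < 1` and `0 < β`, two solutions of the DLR equations `IsHardSphereGibbs σ z β u` coincide.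
Ruelle 1969 Thm 4.2.3 (uniqueness of the Kirkwood–Salsburg solution for `|z| < e^{-2βB-1} C(β)⁻¹`) at the level of
DLR measures, via the tree's disagreement bound (Michelen–Perkins 2021 Thm 3 / Thm 25).
[cite: MichelenPerkins2021, Thm 3 and Thm 25] -/
theorem _root_.Literature.Analysis.FluidPDE.IsHardSphereGibbs.unique_of_small_activity (hσ : 0 < σ) (hz : 0 ≤ z)
    (hzσ : 16 * (z * σ ^ 3) < 1) (hβ : 0 < β) {μ μ' : Measure (PointConfig Phase)}
    (hμ : IsHardSphereGibbs σ z β u μ) (hμ' : IsHardSphereGibbs σ z β u μ') : μ = μ' := by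
  obtain ⟨h0, hm, hκ0, hκ, hκ1, hfin⟩ := smul_prod_uniqueness_hypotheses hσ hz hzσ hβ u
  haveI := isProbabilityMeasure_withDensity_maxwellianBeta hβ u
  exact IsHsLocalGibbs.unique_of_small_activity _ hσ h0 hm hκ0 hκ hκ1 hfin
    (isHsLocalGibbs_of_isHardSphereGibbs u hz hβ hμ) (isHsLocalGibbs_of_isHardSphereGibbs u hz hβ hμ')

/-- **The low-activity hard-sphere Gibbs state is translation invariant** (`ℝ³`): for `0 < σ`, `0 ≤ z`,
`16 z σ³ < 1`, `0 < β`, every solution of `IsHardSphereGibbs σ z β u` is invariant under the spatial translations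
`(q, v) ↦ (q + a, v)` — its translate solves the same DLR equations (`IsHsLocalGibbs.map_shift`, the intensity
`z · Leb ⊗ M_β(v-u)dv` being translation invariant), hence equals it by uniqueness. [cite: Ruelle1969, §4.2 Thm 4.2.3] -/
theorem _root_.Literature.Analysis.FluidPDE.IsHardSphereGibbs.isTranslationInvariant_of_small_activity (hσ : 0 < σ)
    (hz : 0 ≤ z) (hzσ : 16 * (z * σ ^ 3) < 1) (hβ : 0 < β) {μ : Measure (PointConfig Phase)}
    (hμ : IsHardSphereGibbs σ z β u μ) : Literature.Analysis.FluidPDE.IsTranslationInvariant μ := by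
  obtain ⟨h0, hm, hκ0, hκ, hκ1, hfin⟩ := smul_prod_uniqueness_hypotheses hσ hz hzσ hβ u
  haveI := isProbabilityMeasure_withDensity_maxwellianBeta hβ u
  set M : Measure Pos := (volume : Measure Pos).withDensity fun v => ENNReal.ofReal (maxwellianBeta β (v - u)) with hM
  haveI : IsLocallyFiniteMeasure ((Real.toNNReal z) • ((volume : Measure Pos).prod M)) := by infer_instance
  have hG := isHsLocalGibbs_of_isHardSphereGibbs u hz hβ hμ
  intro a
  have hG' := IsHsLocalGibbs.map_shift (a := a) h0 (smul_prod_map_add z M a) hG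
  exact IsHsLocalGibbs.unique_of_small_activity _ hσ h0 hm hκ0 hκ hκ1 hfin hG' hG

/-- **At small activity a hard-sphere Gibbs state of the unit-diameter gas is THE chosen state**
`hsLocalGibbsState 1 (z · Leb ⊗ M_β(v-u)dv)` of `DiluteHardSphereGasProofs` (`0 ≤ z < 1/16`, `0 < β`). [folklore] -/
theorem _root_.Literature.Analysis.FluidPDE.IsHardSphereGibbs.eq_hsLocalGibbsState (hz : 0 ≤ z) (hz1 : z < 1 / 16)
    (hβ : 0 < β) {μ : Measure (PointConfig Phase)} (hμ : IsHardSphereGibbs 1 z β u μ) :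
    μ = hsLocalGibbsState 1 ((Real.toNNReal z) • ((volume : Measure Pos).prod
      ((volume : Measure Pos).withDensity fun v => ENNReal.ofReal (maxwellianBeta β (v - u))))) :=
  hμ.unique_of_small_activity one_pos hz (by nlinarith) hβ (hsLocalGibbsState_isHardSphereGibbs hz hz1 hβ u).2.1

end Unique

end Literature.MathematicalPhysics.StatisticalMechanics

end
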